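import Summits.QuantumFields.BalabanUV.Beta.GAN24.WoodburyFibreLandauZd

/-!
# Beta / GAN24 / WoodburyFibreProjectorZd — census row V11, `ℤ^{d+1}` half (exact part): an2's `R(1) = L·Sb·L` — the unit-lattice
Laplacian on both variables of the brick (G″) kernel `Sb` — is a SYMMETRIC IDEMPOTENT kernel whose columns lie in `L(N(Q))` and which
fixes `L(N(Q))`: the orthogonal projection of [B9] (3.21) at `U = 1`, at EVERY `N ≥ 1`, exactly

Cell `pub-balaban`, β sub-cell, BINDER ROW **G-an2-4 ∕ (CONV-C)** («NOT IN PRINT; our proof attempt»), prover part **P3 = WOODBURY-FIBRE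
reduction** (lineage `b2b-balaban-gan24-p3`, gen 7).  HONEST FRAMING (verbatim): discharging `BetaPertH` makes Bałaban's UV stability
UNCONDITIONAL — a real constructive-QFT result; it is NOT the continuum limit and NOT the Clay problem.  HONEST DEPENDENCY: continuum YM
on T⁴ ⇐ BetaPertH ∧ nine spine estimates (0/9 proved); BetaPertH ⇐ (D1) ∧ (D4) ∧ CAP+tail; G-an2-4 gates asym, D1 and NE2/3/4.
`[folklore]`; 0 sorry; an2's `Beta/BiLaplaceBlockKKT`, `Beta/BiLaplaceBlockGreen`, `Beta/KKTFluctuationEnergy` are imported and used BY NAME,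
not edited; nothing printed and nothing programme-internal is a hypothesis.  NOT (CONV-C), NOT «G-an2-4 closed», NOT `BetaPertH`.

OBJECT.  `Rb N x x′ := L_x L_{x′} Sb N x x′` (`L = codiff₁ ∘ dz` on each variable) — the kernel of the operator product `L·𝒮·L`, `𝒮 = Sb`
an2's block-sum-constrained inverse of `L∘L` on `ℤ^{d+1}` (AN2.md §16.4: «R(1) = L𝒮L as a kernel and its projection property … located,
not typed»; print locator [B9] CMP 99 (1985) p. 394 (3.21)–(3.25), p. 426 (2.27): `R = Δ𝒮Δ` is the orthogonal projection onto `Δ N(Q′)`).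

CONTENTS (sharp constraint, `U = 1`, every `N ≥ 1`).  §1 `Rb`; the two stencils commute (`lap2_swap`), hence **`Rb` is symmetric**
(`Rb_symm`, from `Sb_symm`); column form `Rb N x x′ = L(a ↦ μ_a(x′))(x)`, `μ_a = L S_a`, `S_a = SbCol a`.  §2 **`Rb` IS IDEMPOTENT**:
`Σ'_z Rb x z · Rb z x′ = Rb x x′` (`tsum_Rb_mul_Rb`) — a corollary of an2's ENERGY IDENTITY `Sb a e = ⟨L S_a, L S_e⟩` (`Sb_eq_lip0`):
`Σ_z Rb(x,z)Rb(z,x′) = Σ_{a,e} L(x,a)L(x′,e)⟨L S_a, L S_e⟩ = Σ_{a,e} L(x,a)L(x′,e) Sb(a,e) = Rb(x,x′)`.  §3 **RANGE**: the columns `Rb(·, x′) = L μ_{x′}`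
have `μ_{x′}` of ZERO BLOCK SUMS (`blockSum_muCol`, from `Sb_M`) — range ⊆ `L(N(Q))` ((3.21) ⊆, (3.22)'s «Rf = Δλ₀, λ₀ ∈ N(Q′)»); and `R` FIXES
`L(N(Q))`: `Σ'_z Rb x z · (Lλ)(z) = (Lλ)(x)` for every summable `λ` with zero block sums (`tsum_Rb_mul_lap`; by parts twice via an2's
`lip0_codiff₁`∕`lip1_dz`, then (EL_b) `L(L S_u) = W_u + δ_u` and the M∕G complementarity `tsum_mul_eq_zero_of_blockConst`).  The N-UNIFORM
smallness of `1 − R` along `N = L^k` is the sequel `WoodburyFibreProjectorZdDecay` (box exhaustion + `WoodburyFibreProjector.one_sub_projR_decay`).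
-/

namespace Summit.QuantumFields.BalabanUV.Beta.GAN24.WoodburyFibreProjectorZd

open Finset
open Literature.MathematicalPhysics.QuantumFieldTheory
open Literature.MathematicalPhysics.QuantumFieldTheory.Balaban1983to89
open B4Reflection242 (nbrs mem_nbrs)
open Beta.AffineAveraging (dz codiff₁ box toSite blockSum)
open Beta.KKTFluctuationEnergy (lip0 lip1 lip1_dz lip0_codiff₁ summable_mul_of_bdd summable_dz abs_dz_le tsum_mul_eq_zero_of_blockConst)
open Beta.ScalarBlockGreen (δS)
open Beta.BiLaplaceBlockKKT (Sb Sb_M)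
open Beta.BiLaplaceBlockGreen (SbCol lapN_SbCol_bdd_summable lapLapN_SbCol WbAdj WbAdj_bdd isBlockConst_WbAdj Sb_eq_lip0 Sb_symm)
open WoodburyFibreLandauLimit (lap_apply lap_eq_sum_nbrs)

noncomputable section

variable {d : ℕ}

/-! ## §1 The kernel `R = L·𝒮·L`, symmetry, column form -/

/-- **an2's `R(1)`**: the unit-lattice Laplacian applied to both variables of the brick (G″) kernel `Sb`. [folklore] -/
def Rb (n : ℕ) [NeZero n] (x x' : Fin (d + 1) → ℤ) : ℝ :=
  codiff₁ (dz (fun z => codiff₁ (dz (fun w => Sb (N := n) z w)) x')) x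

/-- the two stencils commute: for ANY kernel `F`, `L₁L₂F (x, x′) = L₁L₂Fᵀ (x′, x)`. [folklore] -/
theorem lap2_swap (F : (Fin (d + 1) → ℤ) → (Fin (d + 1) → ℤ) → ℝ) (x x' : Fin (d + 1) → ℤ) :
    codiff₁ (dz (fun z => codiff₁ (dz (fun w => F z w)) x')) x = codiff₁ (dz (fun z => codiff₁ (dz (fun w => F w z)) x)) x' := by
  simp only [lap_apply, Finset.mul_sum, ← Finset.sum_sub_distrib]
  rw [Finset.sum_comm]
  exact Finset.sum_congr rfl fun μ _ => Finset.sum_congr rfl fun ν _ => by ring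

/-- **`R` is symmetric** (from an2's `Sb_symm`). [folklore] -/
theorem Rb_symm (n : ℕ) [NeZero n] (x x' : Fin (d + 1) → ℤ) : Rb (d := d) n x x' = Rb n x' x := by
  unfold Rb
  rw [lap2_swap]
  exact congrArg (fun F => codiff₁ (dz F) x')
    (funext fun z => congrArg (fun G => codiff₁ (dz G) x) (funext fun w => Sb_symm _ _))

/-- `μ_a := L S_a`, the Laplacian of an2's column `S_a = Sb(·, a)`. [folklore] -/
def muCol (n : ℕ) [NeZero n] (a : Fin (d + 1) → ℤ) : (Fin (d + 1) → ℤ) → ℝ := codiff₁ (dz (SbCol (N := n) a))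

/-- **column form**: `Rb N x x′ = L(a ↦ μ_a(x′))(x)`. [folklore] -/
theorem Rb_eq_lap_muCol (n : ℕ) [NeZero n] (x x' : Fin (d + 1) → ℤ) :
    Rb n x x' = codiff₁ (dz (fun a => muCol n a x')) x := by
  unfold Rb muCol
  refine congrArg (fun F => codiff₁ (dz F) x) (funext fun a => ?_)
  exact congrArg (fun G => codiff₁ (dz G) x') (funext fun w => by show Sb a w = Sb w a; exact Sb_symm _ _)

/-- `μ_u(x′) = Σ_{e ∈ nbrs x′} (Sb x′ u − Sb e u)`. [folklore] -/
theorem muCol_apply (n : ℕ) [NeZero n] (u x' : Fin (d + 1) → ℤ) :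
    muCol n u x' = ∑ e ∈ nbrs x', (Sb (N := n) x' u - Sb (N := n) e u) := by
  unfold muCol; rw [lap_eq_sum_nbrs]; rfl

/-- `Rb N x z = Σ_{a ∈ nbrs x} (μ_x(z) − μ_a(z))`. [folklore] -/
theorem Rb_eq_sum (n : ℕ) [NeZero n] (x z : Fin (d + 1) → ℤ) : Rb n x z = ∑ a ∈ nbrs x, (muCol n x z - muCol n a z) := by
  rw [Rb_eq_lap_muCol, lap_eq_sum_nbrs]

/-! ## §2 Idempotence from the energy identity -/

/-- bounds and summability of the `μ_a`, and the energy identity `Σ'_z μ_a(z) μ_e(z) = Sb a e` (an2's `Sb_eq_lip0`). [folklore] -/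
theorem muCol_facts (n : ℕ) [NeZero n] : ∃ C : ℝ, 0 ≤ C ∧ (∀ a z : Fin (d + 1) → ℤ, |muCol n a z| ≤ C)
    ∧ (∀ a : Fin (d + 1) → ℤ, Summable (muCol n a))
    ∧ ∀ a e : Fin (d + 1) → ℤ, ∑' z, muCol n a z * muCol n e z = Sb (N := n) a e := by
  obtain ⟨C, hC, hbdd, hsum⟩ := lapN_SbCol_bdd_summable (N := n) (d := d)
  refine ⟨C, hC, fun a z => hbdd a z, fun a => hsum a, fun a e => ?_⟩
  rw [Sb_eq_lip0 (N := n) a e]; rfl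

/-- **`R` IS IDEMPOTENT on `ℤ^{d+1}`**: `Σ'_z Rb(x, z)·Rb(z, x′) = Rb(x, x′)` (absolutely convergent). [folklore] -/
theorem tsum_Rb_mul_Rb (n : ℕ) [NeZero n] (x x' : Fin (d + 1) → ℤ) : ∑' z, Rb n x z * Rb n z x' = Rb n x x' := by
  obtain ⟨C, _, hbdd, hsum, hE⟩ := muCol_facts (d := d) n
  have hs : ∀ a e, Summable (fun z => muCol n a z * muCol n e z) := fun a e => summable_mul_of_bdd (hbdd a) (hsum e)
  have hexp : ∀ a e, (fun z => (muCol n x z - muCol n a z) * (muCol n x' z - muCol n e z))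
      = fun z => muCol n x z * muCol n x' z - muCol n x z * muCol n e z - muCol n a z * muCol n x' z + muCol n a z * muCol n e z :=
    fun a e => funext fun z => by ring
  have hprod : ∀ a e, Summable (fun z => (muCol n x z - muCol n a z) * (muCol n x' z - muCol n e z)) := fun a e => by
    rw [hexp]; exact (((hs x x').sub (hs x e)).sub (hs a x')).add (hs a e)
  have hterm : ∀ z, Rb n x z * Rb n z x' = ∑ a ∈ nbrs x, ∑ e ∈ nbrs x', (muCol n x z - muCol n a z) * (muCol n x' z - muCol n e z) := by
    intro z; rw [Rb_eq_sum n x z, Rb_symm, Rb_eq_sum n x' z, Finset.sum_mul_sum]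
  simp_rw [hterm]
  rw [Summable.tsum_finsetSum (fun a _ => summable_sum fun e _ => hprod a e)]
  have hinner : ∀ a, ∑' z, ∑ e ∈ nbrs x', (muCol n x z - muCol n a z) * (muCol n x' z - muCol n e z)
      = ∑ e ∈ nbrs x', (Sb (N := n) x x' - Sb (N := n) x e - Sb (N := n) a x' + Sb (N := n) a e) := by
    intro a
    rw [Summable.tsum_finsetSum (fun e _ => hprod a e)]
    refine Finset.sum_congr rfl fun e _ => ?_
    rw [hexp, (((hs x x').sub (hs x e)).sub (hs a x')).tsum_add (hs a e), ((hs x x').sub (hs x e)).tsum_sub (hs a x'),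
      (hs x x').tsum_sub (hs x e), hE, hE, hE, hE]
  rw [Finset.sum_congr rfl fun a _ => hinner a, Rb_eq_sum n x x']
  refine Finset.sum_congr rfl fun a _ => ?_
  rw [muCol_apply, muCol_apply, ← Finset.sum_sub_distrib]
  refine Finset.sum_congr rfl fun e _ => ?_
  rw [Sb_symm x' x, Sb_symm e x, Sb_symm x' a, Sb_symm e a]
  ring

/-! ## §3 Range: columns in `L(N(Q))`; `R` fixes `L(N(Q))` -/

/-- the columns of `R` are `L μ_{x′}` with `μ_{x′} := a ↦ μ_a(x′)` of ZERO BLOCK SUMS (from `Sb_M` and symmetry): range `⊆ L(N(Q))`,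
the inclusion ⊆ of [B9] (3.21) and the shape «Rf = Δλ₀, λ₀ ∈ N(Q′)» of (3.22). [folklore] -/
theorem blockSum_muCol (n : ℕ) [NeZero n] (x' y : Fin (d + 1) → ℤ) : blockSum n (fun a => muCol n a x') y = 0 := by
  simp only [muCol_apply]
  unfold blockSum
  rw [Finset.sum_comm]
  refine Finset.sum_eq_zero fun e _ => ?_
  have h : ∀ u : Fin (d + 1) → ℤ, ∑ b ∈ box (d + 1) n, Sb (N := n) u ((n : ℤ) • y + toSite b) = 0 := by
    intro u
    have := Sb_M (N := n) u y
    unfold blockSum at this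
    refine (Finset.sum_congr rfl fun b _ => Sb_symm _ _).trans this
  rw [Finset.sum_sub_distrib, h x', h e, sub_self]

/-- **`R` FIXES `L(N(Q))`**: for every summable `λ` with zero block sums, `Σ'_z Rb(x, z)·(Lλ)(z) = (Lλ)(x)` — the inclusion ⊇ of [B9]
(3.21); with §2–§3: `R` is the orthogonal projection onto `L(N(Q))` (on `ℓ¹` data; the kernel statements are exact). [folklore] -/
theorem tsum_Rb_mul_lap (n : ℕ) [NeZero n] {lam : (Fin (d + 1) → ℤ) → ℝ} (hlam : Summable lam)
    (hM : ∀ y, blockSum n lam y = 0) (x : Fin (d + 1) → ℤ) : ∑' z, Rb n x z * codiff₁ (dz lam) z = codiff₁ (dz lam) x := by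
  obtain ⟨C, _, hbdd, hsum, -⟩ := muCol_facts (d := d) n
  obtain ⟨CW, _, hW⟩ := WbAdj_bdd (N := n) (d := d)
    -- the pairing of one `μ_u` with `Lλ` is `λ u`
  have key : ∀ u, ∑' z, muCol n u z * codiff₁ (dz lam) z = lam u := by
    intro u
    have h1 : lip0 (muCol n u) (codiff₁ (dz lam)) = lip1 (dz (muCol n u)) (dz lam) :=
      lip0_codiff₁ (hbdd u) (fun κ => summable_dz hlam κ)
    have h2 : lip1 (dz (muCol n u)) (dz lam) = lip0 (codiff₁ (dz (muCol n u))) lam :=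
      lip1_dz (fun μ z => abs_dz_le (hbdd u) μ z) hlam
    have h3 : codiff₁ (dz (muCol n u)) = WbAdj (N := n) u + δS u := lapLapN_SbCol (N := n) u
    have h4 : ∑' z, (WbAdj (N := n) u z + δS u z) * lam z = lam u := by
      have s1 : Summable (fun z => WbAdj (N := n) u z * lam z) := summable_mul_of_bdd (hW u) hlam
      have s2 : Summable (fun z => δS u z * lam z) :=
        summable_mul_of_bdd (M := 1) (fun z => by unfold δS; split_ifs <;> simp) hlam
      simp_rw [add_mul]
      rw [s1.tsum_add s2, tsum_mul_eq_zero_of_blockConst (N := n) (hW u) (isBlockConst_WbAdj (N := n) u) hlam hM, zero_add]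
      have e : ∀ z, δS u z * lam z = if z = u then lam u else 0 := by
        intro z; unfold δS; split_ifs with h <;> simp [h]
      rw [tsum_congr e, tsum_ite_eq]
    have h12 : lip0 (muCol n u) (codiff₁ (dz lam)) = lip0 (codiff₁ (dz (muCol n u))) lam := h1.trans h2
    unfold lip0 at h12
    rw [h12, h3]
    exact h4
  have hs : ∀ u, Summable (fun z => muCol n u z * codiff₁ (dz lam) z) := fun u =>
    summable_mul_of_bdd (hbdd u) (Beta.KKTFluctuationEnergy.summable_codiff₁ fun κ => summable_dz hlam κ)
  have hterm : ∀ z, Rb n x z * codiff₁ (dz lam) z = ∑ a ∈ nbrs x, (muCol n x z * codiff₁ (dz lam) z - muCol n a z * codiff₁ (dz lam) z) := by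
    intro z; rw [Rb_eq_sum, Finset.sum_mul]; exact Finset.sum_congr rfl fun a _ => sub_mul _ _ _
  simp_rw [hterm]
  rw [Summable.tsum_finsetSum (fun a _ => (hs x).sub (hs a)), lap_eq_sum_nbrs]
  exact Finset.sum_congr rfl fun a _ => by rw [(hs x).tsum_sub (hs a), key, key]

/-! ## §4 Non-vacuity -/

/-- the exact statements at every `N`: idempotence and symmetry on `ℤ⁴` with `N = 2`. -/
example (x x' : Fin (3 + 1) → ℤ) : ∑' z, Rb 2 x z * Rb 2 z x' = Rb 2 x x' ∧ Rb 2 x x' = Rb 2 x' x :=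
  ⟨tsum_Rb_mul_Rb 2 x x', Rb_symm 2 x x'⟩

end

end Summit.QuantumFields.BalabanUV.Beta.GAN24.WoodburyFibreProjectorZd
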